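import Mathlib
import HarnessLib
import HarnessLib.Audit
import Summits.CriticalPhenomena.Statement
import Literature.Probability.Percolation.SeparatingEvents
import Literature.Probability.Percolation.SmirnovTheoremProofs
import Literature.Probability.Percolation.QuadCrossingSpace
import Literature.Analysis.Complex.CauchyPompeiu
import HarnessLib.Audit.Status.Attr

/-!
Route: CardyMaterialLaw

DORMANT since 2026-08-22T09:38:37Z (reconciler: no traction for 5.2 d (last activity item-evidence-added at 2026-08-17T03:10:16Z); parked, not closed — `ledger route dormant route-CriticalPhenomena-CardyMaterialLaw --off` to reactivate) — unstaffed, not closed; items shared with open routes are served there. `ledger route dormant <id> --off` reactivates.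

# Route CardyMaterialLaw — autonomous Cauchy–Riemann defect laws of the Z2 three-arc map die by
DKKMO rotations against the Z3 arc phase

It suffices to show X = AutonomousLaw ∧ LimitRegularity ∧ SeparatingRotationCovariance ∧
Z2SeparatingData (card
cr-material-law, tiers K1/K2/K3/P3). Objects: for a 3-marked Jordan domain T the bond-ℤ² separating
triple
H^δ_α(z) = `bondSeparatingProb T α δ z` (Smirnov's events E_α, B–R Ch. 7 (9)) and any locally
uniform subsequential
limit G = (G₀,G₁,G₂) on T along meshes u_n → 0. AutonomousLaw (K1): along each mesh sequence the
antiholomorphic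
gradients w_α = ∂̄G_α obey ONE material law w = L_s(Σ_α s^{2α} w_α) for all domains (s = e^{±2πi/3}
the Carleson
orientation of T, L_s(0) = 0); LimitRegularity (K2, regularity tier): limits are real-differentiable
on T;
SeparatingRotationCovariance (K3): DKKMO rotation invariance of quad-crossing limits (item
RotationInput) transfers
to G_{α+1}(ρz) = G_α(z) on equilateral triangles (ρ the 2π/3 turn permuting the marks — exact
relabelling);
Z2SeparatingData (P3): the ℤ² discrete half of Bollobás–Riordan Ch. 7 WITHOUT the contour identity
(36).
The kill (item MaterialLawKill): on a triangle the law read at z and ρz forces w_{α+1} = s·w_α, i.e.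
(36) in
differential form; Claim 24 makes the triangle limits affine, sweeping sizes and tilts pins L_s on
ℂ*, so (36)
holds for every domain and bond-ℤ² has Smirnov separating families (item BondSmirnovFamilies),
whence Cardy by the
tree's PROVED continuum half (Claims 22–24, Carleson maps, Cardy–Carleson identity).
Lean: `AutonomousLaw ∧ LimitRegularity ∧ SeparatingRotationCovariance ∧ Z2SeparatingData`

## Assembly
MaterialLawKill turns X (+ RotationInput) into BondSmirnovFamilies; from BondSmirnovFamilies the
deciding theorem `closes`
(glue.lean, sorry-free, axioms propext/Classical.choice/Quot.sound in the planner sketch) runs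
Bollobás–Riordan's last two
pages for bond-ℤ² with the tree's PROVED facts: Arzelà–Ascoli + (M)
`triangleIntegral_eq_zero_of_forall_lattice_holds` +
(U) `smirnov_claim24_holds` give g^±_δ¹(z^±_δ) → |d−c|/|a−c| (`IsSmirnovFamily.tendsto_apply_one`),
the sandwich squeezes
`bondDomainCrossingProb R δ`, and (B) `exists_isCarlesonMap_holds` + (C)
`cardyFunction_crossRatio_eq_carlesonRatio_holds`
turn Carleson's ratio into F(η) for every uniformizing datum: `R.HasCrossingLimit
(bondDomainCrossingProb R) cardyFunction`.

Rationale: WHY THIS LINE. Smirnov's proof needs the LATTICE to turn by 2π/3 (barrier SmirnovTriangularOnly);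
here the DOMAIN turns (DKKMO2020Rotational,
arXiv:2012.11672, the one new theorem on ℤ² since 2001) and the TARGET turns by ω because the three
arcs are exchangeable, and
the Cauchy–Riemann defect ∂̄G of the three-arc map is caught between the trivial character of the
conforming strain ∂G and the
cubic character of the defect: no AUTONOMOUS constitutive relation ∂̄G = ℋ(∂G), linear or nonlinear,
survives (card
cr-material-law; Wirtinger kill Lean-checked in the card's sketch). Imported area: the
Astala–Iwaniec–Martin theory of
nonlinear first-order elliptic systems ∂̄f = ℋ(∂f) and quasiregular maps (AstalaIwaniecMartin2008
Def 7.7.1, Thm 5.5.1,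
8.6.x, 9.0.3) with the explicit dictionary strain ↦ ∂G, defect ↦ ∂̄G, material law ↦ the
constitutive set Σ of the
lattice; the probabilistic frame is Bollobás–Riordan's rendering of Smirnov2001 (BollobasRiordan2006
Ch. 7, (9), Claims
22–24), whose continuum half is PROVED in the tree (`smirnov_claim24_holds`,
`exists_isCarlesonMap_holds`,
`cardyFunction_crossRatio_eq_carlesonRatio_holds`, `IsSmirnovFamily.tendsto_apply_one`), so the
deciding theorem `closes`
is a real 25-line proof from BondSmirnovFamilies. Unlike route CardyHarmonicInvariants (MoreraOnZ2:
a lattice contour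
IDENTITY) or CardyRotToConf (SLE axiomatics), CR is here the OUTPUT of a symmetry acting on a
closure class; the only
CardyFormulaZ2 negative (DualCurrentTemplate, stmt-6949) concerns a local current template and is
not touched.

RANKED CRUXES. #2 AutonomousLaw (crux) — card K1 (AUT), orientation-aware and derivative-level: for
every mesh sequence u_n → 0⁺ there is ONE law L : ℂ → ℂ → (Fin 3 → ℂ) with L s 0 = 0 such that for
every 3-marked Jordan domain T carrying a Carleson datum of orientation s = triangleTurn a b c (ψ :
T → Δ(abc) equilateral, marks ↦ vertices), every locally uniform limit G of (H^{u_n}_α)_α on T and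
every interior point z where G is differentiable, the triple (∂̄G_α(z))_α equals L s (Σ_α s^{2α}
∂̄G_α(z)). In the Cardy world it holds with the linear law L s σ = (σ/3)(1, s, s²) (H_α = 1/3 +
(2/3)Re(ψ s^{-α}) gives ∂̄H_α = conj(ψ')s^α/3); the weighting s^{2α} is the non-degenerate (strain)
Fourier mode, Σ s^α ∂̄G_α the defect. [deps: LimitRegularity] [difficulty: open-problem] (why it
might fail: Unmotivated outside the CI world: the three arc patterns carry three free amplitude
fields, local 3-arm spectral data force no pointwise closure, and the card's Z2 numerics fit only
19–31% of the finite-mesh defect by any material law (kit j001655–j001657).) [arXiv:0909.4499,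
BollobasRiordan2006, AstalaIwaniecMartin2008, Beffara2008Universal]
#3 LimitRegularity (crux) — card K2, regularity tier (what the Wirtinger calculus of K1 needs; the
card's K-quasiregularity is its quantitative form, see § Two-layer plan): every locally uniform
subsequential limit G of the bond-ℤ² separating triple on a 3-marked Jordan domain T is
real-differentiable at every point of T. True in the Cardy world (limits harmonic, hence smooth).
[difficulty: open-problem] (why it might fail: RSW gives only Hölder continuity of limits (B–R Claim
22); no monotonicity couples the directions of ∇G₀, ∇G₁, quasiregular maps are differentiable only
a.e., and a non-CI limit could be nowhere differentiable on a dense set.) [BollobasRiordan2006,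
AstalaIwaniecMartin2008, Kesten1987Scaling, GarbanPeteSchramm2013]
#4 SeparatingRotationCovariance (crux) — card K3: DKKMO rotation invariance of the quad-crossing
scaling limits (hypothesis = the statement of item RotationInput, inlined) transfers to separating
probabilities at interior points: for a 3-marked domain T whose carrier is the open equilateral
triangle on its marks and ρ z = m + l(z − m) the turn permuting the marks cyclically (l(pt i − m) =
pt (i+1) − m), every locally uniform limit G of (H^{u_n}_α)_α satisfies G_{α+1}(ρ z) = G_α(z) on T
(exact relabelling H_α(ρT) = H_{α+1}(T) at every mesh + asymptotic rotation invariance).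
[difficulty: L] (why it might fail: The transfer needs measurability and μ-continuity of E_α(z) in
the Schramm–Smirnov quad space (GPS-type arm events, arXiv:1008.1378 §2) and control of the
nearest-vertex discretisation (`discreteArc`, `nearestSite`) at arcs and corners; a boundary effect
could spoil exact relabelling in the limit.) [DKKMO2020Rotational, SchrammSmirnov2011,
GarbanPeteSchramm2013, Tassion2024]
#5 Z2SeparatingData (crux) — card P3, the ℤ² discrete half of Bollobás–Riordan Ch. 7 WITHOUT (36):
for every conformal rectangle R with a Carleson datum (a,b,c,d,ψ) there are δ₀ > 0 and families gm,
gp : ℝ → Fin 3 → ℂ → ℝ, each continuous and [0,1]-valued on closure Ω, uniformly equicontinuous in δ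
(Claim 22, RSW), with every uniform subsequential limit satisfying the boundary values (37) (Gⁱ = 0
and G^{i+1}+G^{i+2} = 1 on arc i of forgetLast R: one-arm decay + planar duality + self-duality +
half-mesh-shift continuity), asymptotic to the canonical triple (gδⁱ − H^δ_{i+2}(forgetLast R) → 0
locally uniformly on Ω), and sandwiching the crossing probability: gm δ 1 (zm δ) − e δ ≤
bondDomainCrossingProb R δ ≤ gp δ 1 (zp δ) + e δ with z± → d′, e → 0 ((40), (19)). [difficulty: XL]
(why it might fail: (37) on bond-Z2 needs duality + self-duality + continuity under the half-mesh
shift of the dual lattice, and the sandwich needs a Lemma-14-type inner/outer approximation for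
`discreteCrossing` on Z2 (in tree only for the triangular lattice); rough Jordan boundaries may
defeat nearest-vertex arcs.) [BollobasRiordan2006, Smirnov2001, Kesten1987Scaling, Grimmett2018,
Werner2007]
#9 RotationInput (support) — DKKMO rotation invariance in ℋ form (arXiv:2012.11672 Thm 1.2 / Cor 1.3
at q = 1; Tassion2024): every subsequential quad-crossing limit of bond-ℤ² over the whole plane is
invariant under all rotations. A published theorem, in tree only per quad and unproved
(`dkkmo_crossing_rotation_invariance`); kept as an explicit item (shared verbatim with route
CardySelfRefinement) so that the deciding theorem has no hidden hypothesis and the cone stays clean.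
[difficulty: L] [DKKMO2020Rotational, Tassion2024, SchrammSmirnov2011]
#9 MaterialLawKill (support) — the card's tier (B) as one analytic theorem (ℤ₃-kill + sweep):
AutonomousLaw → LimitRegularity → SeparatingRotationCovariance → RotationInput → Z2SeparatingData →
BondSmirnovFamilies. Proof plan: fix R, Carleson datum of orientation s, a family g of
Z2SeparatingData and a uniform limit G along u (so H(forgetLast R) → G locally uniformly on Ω); for
z ∈ Ω with strain σ(z) ≠ 0 take the equilateral `triangleRectangle` T′ of orientation s whose
Carleson-affine limit has strain σ(z) (Claim 24 `smirnov_claim24_holds` with ψ = refl, after the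
kill: on T′, covariance + chain rule give w(ρz) = s·shift w(z) while the law at z and ρz gives w(ρz)
= w(z), so w_{α+1} = s w_α), pass to a subsequence of u along which T′ converges (equicontinuity
from Z2SeparatingData + Arzelà–Ascoli) and read the law of that subsequence at both domains: w(z) =
L′ s σ(z) ∈ {w_{α+1} = s w_α}; σ(z) = 0 uses L s 0 = 0. Hence G_{i+1} − s G_i is ℂ-differentiable on
Ω, Cauchy–Goursat gives (36) on every solid triangle, and g is an IsSmirnovFamily. [difficulty: M]
[BollobasRiordan2006, AstalaIwaniecMartin2008, arXiv:0909.4499]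
#9 BondSmirnovFamilies (support) — the hinge — Bollobás–Riordan's discrete half (D) for BOND
percolation on ℤ² at 1/2: for every conformal rectangle with a Carleson datum there are δ₀ > 0 and
two Smirnov separating families (tree `IsSmirnovFamily`: continuity, [0,1] values, Claim 22
equicontinuity, (36) on lattice-parallel triangles and (37) for subsequential limits) sandwiching
`bondDomainCrossingProb R δ` near d′. Literally `smirnov_exists_separatingFamilies` with
`triDomainCrossingProb` replaced by `bondDomainCrossingProb`; any route delivering (36) on ℤ² closes
it, and `closes` derives CardyFormulaZ2 from it by the tree's proved continuum half. [difficulty: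
open-problem] [BollobasRiordan2006, Smirnov2001, Beffara2007]

TWO-LAYER PLAN. Foreseen glued splits (none filed now): Z2SeparatingData ⇐ Z2Claim22 (RSW
equicontinuity + interpolation, provable now) →
Z2Claim23Boundary ((37) via duality/self-duality/shift) → Z2Sandwich ((40)+(19) for
`discreteCrossing`) → Z2SeparatingData;
SeparatingRotationCovariance ⇐ SepEventMeasurable (E_α(z) is a μ-continuity event of the quad
σ-field) → ExactRelabelling →
SeparatingRotationCovariance; AutonomousLaw ⇐ LinearLawsTrivial (card P2: the 12-group
classification, provable now) →
NonlinearClosure. Graceful tier (card (A), not deciding): once `IsQuasiregularOn` and quad moduli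
exist, K-quasiregular
limits ⇒ F(Km) ≤ liminf P_δ(Q) ≤ limsup ≤ F(m/K) (Stoilow + Grötzsch) as a support item under
LimitRegularity.

KILL CRITERIA. ¬AutonomousLaw (two domains/points with equal strain and different defect along one
mesh sequence, or an RSW argument
that limits cannot obey a universal closure) closes the route `refuted:AutonomousLaw` — the card
then survives only as
negative knowledge ("no material-law counterexample to Cardy"). ¬LimitRegularity forces a pivot to a
Sobolev/quasiregular
restatement (AIM's W^{1,2} class) once Literature has it; ¬SeparatingRotationCovariance with
RotationInput granted means the
quad-to-separating transfer fails — pivot to the loop form `dkkmo_rotation_invariance`;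
¬Z2SeparatingData as typed is a
misstatement of the discretisation (repair with B–R inner/outer approximating domains, new item).
BondSmirnovFamilies or
CardyHarmonicInvariants.MoreraOnZ2 proved elsewhere moots the cruxes and closes the conjunct through
`closes`.

NOT DECOMPOSED YET. The measurability/continuity lemma for E_α(z) in the Schramm–Smirnov space; the
interpolation (32)–(34) and the boundary
estimates of Claim 22/23 on ℤ²; Cauchy–Goursat for solid triangles and the explicit strain of
`carlesonLinear` (inside
MaterialLawKill, lemmas ride with `--supports`); the card's P2 (linear-law classification), (A′)
energy/Douglas identity and
tier (A) distortion sandwich (need `IsQuasiregularOn`, quadrilateral modulus — not requested at open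
to keep the route thin).

CHEAPEST FALSIFIER. Numerics already running for the card (kit j001658–j001661, j001692–j001693,
j001740–j001743: n = 24…64): if the
material-law (joint linear + autonomous) fit fraction of the finite-mesh defect does not rise
towards 1 and K_p95 does
not fall as δ → 0, AutonomousLaw is empirically dead and the route should be closed before any
prover time; at n ≤ 16 the
fit explains only 19–31% (j001655–j001657). Theory-cheap: a refuter's check that the s^{2α}-weighted
strain is the
non-degenerate mode (done by hand here: in the Cardy world ∂̄H_α = conj(ψ′)s^α/3, strain = conj(ψ′)
≠ 0, law linear).

NUMBERS. Card numerics (bond-ℤ² backbone triple, 3·10⁵ samples, n = 16; kit j001651,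
j001655–j001657): |∂̄G|/|∂G| median
0.025–0.039, p95 0.045 (rect 3:2) / 0.066 (L) / 0.09 (square); K_p95 = 1.09 / 1.14 / 1.21, K_max ≤
1.23, Jacobian > 0
everywhere; joint linear fit of the defect 19–31%; energy deficit 0.17 (n=8) → 0.12 (12) → 0.093
(16) ≈ δ^0.9 with
anharmonic part ≤ 3.5·10⁻⁴; |ΣH_α − 1| ≤ 0.04. Exponents: P^± ≍ δ^{2/3} (3-arm half-plane-type
dipole), P⁺ − P⁻ ≍ δ
(arXiv:0909.4499 Rem. 4). Items at open: 8 (4 cruxes).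

DEFINITION REQUESTS. None at open: `bondSeparatingProb` (SeparatingEvents), `dbarAlong`
(CauchyPompeiu), `IsSmirnovFamily`/`IsSeqLimit`/
`triangleTurn`/`forgetLast` (SmirnovContinuumLimit), `subseqQuadLimits`/`isometryLaw`
(QuadCrossingSpace), `triangleRectangle`
(TriangleDomain) all exist. Later (tier A only): `IsQuasiregularOn`, conformal modulus of a quad.

Novelty: Searches (2026-08-15): `lit frontier CriticalPhenomena --since 2023` (30 rows: DKKMO follow-ups on
Wulff crystals, fuzzy
Potts, GFF arms — none on closure laws or quasiregularity for crossing probabilities); `lit bridges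
CriticalPhenomena --cross
any` (30 generic rows); `lit galaxy search "quasiconformal quasiregular percolation crossing
probability Cardy formula square
lattice" --star all` (0); `lit galaxy search … --star pdf --mode intelligent` "quasiregular maps or
nonlinear Beltrami
equations for percolation crossing probabilities" (10: Smirnov ICM06, Maier math-ph/0210013,
SchrammSmirnov2011, Angel
math/0501006, Dubédat math/0302250, Rohde 1007.2007 — none combine); `lit search --hybrid` local
"quasiregular Beltrami distortion percolation crossing probability conformal invariance square
lattice" (10 percolation/statistical-physics textbooks, no combination); `lit search` remote cascade
unavailable this session (searchd rc 75) — the card's zbMATH/hybrid/bm25 searches of the same day (0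
hits for quasiregular/Beltrami × percolation)
relied on; in-tree: 50 Theses of the sub read by title,
CardyHarmonicInvariants/CardyRotToConf/CardySelfRefinement in full.
Nearest prior art found: Beffara2008Universal (arXiv:0708.3908 Prop. 4) +
Langlands–Pouliot–Saint-Aubin (math/9401222):
the ℂ-LINEAR sub-case of the constitutive set, killed by the quarter turn; DKKMO2020Rotational
(input); in-ledger
CardyHarmonicInvariants (Morera identity programme) and CardySelfRefinement (RotationInput  [refs: 0708.3908, SchrammSmirnov2011]

Barriers (technique_class: nonlinear-beltrami-closure, qr-distortion, dkkmo-rotation): - technique_class: nonlinear-beltrami-closure, qr-distortion, dkkmo-rotation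
- Literature.Barriers.CriticalPhenomena.SmirnovTriangularOnly: evaded — no colour switching, no
ψ(e), no lattice 2π/3 turn and no contour identity (36) at any mesh; the turn is of the DOMAIN
(DKKMO, asymptotic) and of the LABELS (exact), and (36) is the output of MaterialLawKill.
- Literature.Barriers.CriticalPhenomena.EmbeddingModulusUniqueness: consistent — the line is
embedding-sensitive: on a sheared ℤ² RotationInput fails, the constitutive set stays a complex line
and the kill correctly does not fire; nothing here is blind to the modulus.
- Literature.Barriers.CriticalPhenomena.CoveringLatticeShift: not in class — no covering-lattice
interpolation or colour flip; primal/dual asymmetry enters only through (37) inside Z2SeparatingData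
(duality + self-duality + shift continuity), which is where the bet on this barrier sits.
- Literature.Barriers.CriticalPhenomena.FKParafermionicHalfCauchyRiemann: not in class — the
observable is Smirnov's three-arc triple (RSW-precompact on ℤ²), not the FK parafermion, and no
discrete CR relation is asserted; the missing half of CR is replaced by a closure hypothesis
(AutonomousLaw), openly the bet.
- Literature.Barriers.CriticalPhenomena.ScaleCovarianceNotMoebius: in spirit only (it is catalogued
for Ising3D) — model-blind symmetry upgrades fail; here the input is model-specific (three
exchangeable arcs + DKKMO) and even full conformal covariance is known insuffic

Novelty grade: new-combination — route-review grade (refuter-rreview-0815T16-4-0). Delta confirmed as stated: no printed autonomous/nonlinear constitutive law dbar G = H(dG) for a percolation observable, and no prior join of DKKMO's asymptotic all-angle rotation with the Z3 arc-exchange phase of Smirnov's three-arc map (grounder g2 (refuter refuter-rreview-0815T16-4-0, 2026-08-15T17:36:29Z; prior: arXiv:2012.11672 (DKKMO 2020, rotational invariance of crossing probabilities on Z2, the input), AstalaIwaniecMartin2008 Def 7.7.1 / Thm 5.5.1 / 8.6.x (nonlinear first-order elliptic systems dbar f = H(df), vocabulary only), arXiv:0909.4499 (Smirnov, Lemma 2.1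 + Remark 5: 2pi/3 Cauchy-Riemann relations on triangulations; the linear CI-world law), arXiv:0708.3908 (Beffara, Prop. 4: C-linear combina)

History (route lifecycle, newest last):
- 2026-08-22T09:38:37Z · DORMANT — reconciler: no traction for 5.2 d (last activity item-evidence-added at 2026-08-17T03:10:16Z); parked, not closed — `ledger route dormant route-CriticalPhenomen (operator:999:990491)

sub-problem: CardyFormulaZ2 · status: dormant · opened planner-plancard-CriticalPhenomena-CardyFormu-1b5f4ed1-0 2026-08-15T16:53:20Z · rev 2 · ledger route-CriticalPhenomena-CardyMaterialLaw
GENERATED by the gate from the ledger (D-0016/17). Provers cite these decls: `theorem foo : Summit.CriticalPhenomena.CardyFormulaZ2.Theses.CardyMaterialLaw.<Decl> := …` in Summits/CriticalPhenomena/CardyFormulaZ2/Theorems/<Name>.lean.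
-/

namespace Summit.CriticalPhenomena.CardyFormulaZ2.Theses.CardyMaterialLaw

open scoped BigOperators Topology Manifold Classical MeasureTheory ProbabilityTheory Matrix InnerProductSpace ComplexConjugate ContinuousMap
open Filter Set Function TopologicalSpace MeasureTheory

attribute [summit_statement] _root_.CardyFormulaZ2

/-- item stmt-CriticalPhenomena-11171 · crux · rank 2 · open · by planner
why it might fail: Restatement-strength: CI gives the linear law L_s σ=(σ/3)(1,s,s²), but if Cardy fails on ℤ² nothing forces ONE pointwise closure ∂̄G=L(strain) across all domains — three arc patterns carry three free amplitude fields, 3-arm data give no closure; card numerics fit only 19–31% of the defect.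
sources: arXiv:0909.4499, BollobasRiordan2006, AstalaIwaniecMartin2008, Beffara2008Universal
[crux] card K1 (AUT), orientation-aware and derivative-level: for every mesh sequence u_n → 0⁺ there
is ONE law L : ℂ → ℂ → (Fin 3 → ℂ) with L s 0 = 0 such that for every 3-marked Jordan domain T
carrying a Carleson datum of orientation s = triangleTurn a b c (ψ : T → Δ(abc) equilateral, marks ↦
vertices), every locally uniform limit G of (H^{u_n}_α)_α on T and every interior point z where G is
differentiable, the triple (∂̄G_α(z))_α equals L s (Σ_α s^{2α} ∂̄G_α(z)). In the Cardy world it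
holds with the linear law L s σ = (σ/3)(1, s, s²) (H_α = 1/3 + (2/3)Re(ψ s^{-α}) gives ∂̄H_α =
conj(ψ')s^α/3); the weighting s^{2α} is the non-degenerate (strain) Fourier mode, Σ s^α ∂̄G_α the
defect. [deps: LimitRegularity] [difficulty: open-problem] -/
@[route_item "route-CriticalPhenomena-CardyMaterialLaw", crux]
def AutonomousLaw : Prop :=
  ∀ u : ℕ → ℝ, (∀ n, 0 < u n) → Filter.Tendsto u Filter.atTop (nhds 0) → ∃ L : ℂ → ℂ → (Fin 3 → ℂ), (∀ s, L s 0 = 0) ∧ ∀ (T : Literature.Probability.RandomPlanarGeometry.MarkedDomain 3) (a b c : ℂ) (ψ : Literature.Probability.RandomPlanarGeometry.ConformalEquiv T.carrier (Literature.Probability.Percolation.openTriangle a b c)), Literature.Probability.Percolation.IsEquilateral a b c → ψ.HasBoundaryValue (T.pt 0) a → ψ.HasBoundaryValue (T.pt 1) b → ψ.HasBoundaryValue (T.pt 2) c → ∀ G : Fin 3 → ℂ → ℝ, (∀ α : Fin 3, TendstoLocallyUniformlyOn (fun (n : ℕ) (z : ℂ) => Literature.Probability.Percolation.bondSeparatingProb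 T α (u n) z) (G α) Filter.atTop T.carrier) → ∀ z ∈ T.carrier, (∀ α, DifferentiableAt ℝ (G α) z) → (fun α : Fin 3 => Literature.Analysis.Complex.dbarAlong (1 : ℂ) (fun w : ℂ => (G α w : ℂ)) z) = L (Literature.Probability.Percolation.triangleTurn a b c) (∑ α : Fin 3, Literature.Probability.Percolation.triangleTurn a b c ^ (2 * (α : ℕ)) * Literature.Analysis.Complex.dbarAlong (1 : ℂ) (fun w : ℂ => (G α w : ℂ)) z)

/-- item stmt-CriticalPhenomena-11172 · crux · rank 3 · open · by planner
why it might fail: Asks differentiability at EVERY point of EVERY subsequential limit on EVERY 3-marked Jordan domain: RSW gives only Hölder equicontinuity (B–R Claim 22 p.197), K-quasiregular maps are differentiable only a.e. (AIM Ch. 3), and without CI a limit may be nowhere differentiable — CI-strength regularity.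
sources: BollobasRiordan2006, AstalaIwaniecMartin2008, Kesten1987Scaling, GarbanPeteSchramm2013
[crux] card K2, regularity tier (what the Wirtinger calculus of K1 needs; the card's
K-quasiregularity is its quantitative form, see § Two-layer plan): every locally uniform
subsequential limit G of the bond-ℤ² separating triple on a 3-marked Jordan domain T is
real-differentiable at every point of T. True in the Cardy world (limits harmonic, hence smooth).
[difficulty: open-problem] -/
@[route_item "route-CriticalPhenomena-CardyMaterialLaw", crux]
def LimitRegularity : Prop :=
  ∀ (T : Literature.Probability.RandomPlanarGeometry.MarkedDomain 3) (u : ℕ → ℝ) (G : Fin 3 → ℂ → ℝ), (∀ n, 0 < u n) → Filter.Tendsto u Filter.atTop (nhds 0) → (∀ α : Fin 3, TendstoLocallyUniformlyOn (fun (n : ℕ) (z : ℂ) => Literature.Probability.Percolation.bondSeparatingProb T α (u n) z) (G α) Filter.atTop T.carrier) → ∀ α : Fin 3, DifferentiableOn ℝ (G α) T.carrier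

/-- item stmt-CriticalPhenomena-11174 · crux · rank 5 · open · by planner
why it might fail: B–R run Claims 22–23 on Lemma-14 domains G_δ^± (local connectivity p.184/198, boundary treatment p.195), not on Ω∩δℤ²; for EVERY Jordan R the typed interior agreement with naive H^δ and (37) need an unwritten ℤ² Lemma 14 + bond duality on the half-shifted dual; rough boundaries may misstate it.
sources: BollobasRiordan2006, Smirnov2001, Kesten1982, Grimmett2018, Werner2007
[crux] card P3, the ℤ² discrete half of Bollobás–Riordan Ch. 7 WITHOUT (36): for every conformal
rectangle R with a Carleson datum (a,b,c,d,ψ) there are δ₀ > 0 and families gm, gp : ℝ → Fin 3 → ℂ →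
ℝ, each continuous and [0,1]-valued on closure Ω, uniformly equicontinuous in δ (Claim 22, RSW),
with every uniform subsequential limit satisfying the boundary values (37) (Gⁱ = 0 and
G^{i+1}+G^{i+2} = 1 on arc i of forgetLast R: one-arm decay + planar duality + self-duality +
half-mesh-shift continuity), asymptotic to the canonical triple (gδⁱ − H^δ_{i+2}(forgetLast R) → 0
locally uniformly on Ω), and sandwiching the crossing probability: gm δ 1 (zm δ) − e δ ≤
bondDomainCrossingProb R δ ≤ gp δ 1 (zp δ) + e δ with z± → d′, e → 0 ((40), (19)). [difficulty: XL] -/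
@[route_item "route-CriticalPhenomena-CardyMaterialLaw", crux]
def Z2SeparatingData : Prop :=
  ∀ (R : Literature.Probability.RandomPlanarGeometry.ConformalRectangle) (a b c d : ℂ) (ψ : Literature.Probability.RandomPlanarGeometry.ConformalEquiv R.carrier (Literature.Probability.Percolation.openTriangle a b c)), Literature.Probability.Percolation.IsEquilateral a b c → d ∈ openSegment ℝ c a → Literature.Probability.Percolation.IsCarlesonMap R a b c d ψ → ∃ δ₀ > (0 : ℝ), ∃ gm gp : ℝ → Fin 3 → ℂ → ℝ, (∀ g : ℝ → Fin 3 → ℂ → ℝ, (g = gm ∨ g = gp) → (∀ δ ∈ Set.Ioo 0 δ₀, ∀ i, ContinuousOn (g δ i) (closure R.carrier)) ∧ (∀ δ ∈ Set.Ioo 0 δ₀, ∀ i, ∀ z ∈ closure R.carrier, g δ i z ∈ Set.Icc (0 : ℝ) 1) ∧ (∀ i, ∀ β > (0 : ℝ), ∃ η > (0 : ℝ), ∀ δ ∈ Set.Ioo 0 δ₀, ∀ z ∈ closure R.carrier, ∀ w ∈ closure R.carrier, dist z w < η → dist (g δ i z) (g δ i w) < β) ∧ (∀ G, Literature.Probability.Percolation.IsSeqLimit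 R δ₀ g G → ∀ (i : Fin 3), ∀ z ∈ (Literature.Probability.RandomPlanarGeometry.MarkedDomain.forgetLast R).arc i, G i z = 0 ∧ G (i + 1) z + G (i + 2) z = 1) ∧ (∀ i : Fin 3, TendstoLocallyUniformlyOn (fun (δ : ℝ) (z : ℂ) => g δ i z - Literature.Probability.Percolation.bondSeparatingProb (Literature.Probability.RandomPlanarGeometry.MarkedDomain.forgetLast R) (i + 2) δ z) (fun _ => 0) (nhdsWithin 0 (Set.Ioi 0)) R.carrier)) ∧ ∃ (zm zp : ℝ → ℂ) (e : ℝ → ℝ), (∀ δ ∈ Set.Ioo 0 δ₀, zm δ ∈ R.carrier ∧ zp δ ∈ R.carrier) ∧ Filter.Tendsto zm (nhdsWithin 0 (Set.Ioi 0)) (nhds (R.pt 3)) ∧ Filter.Tendsto zp (nhdsWithin 0 (Set.Ioi 0)) (nhds (R.pt 3)) ∧ Filter.Tendsto e (nhdsWithin 0 (Set.Ioi 0)) (nhds 0) ∧ ∀ δ ∈ Set.Ioo 0 δ₀, gm δ 1 (zm δ) - e δ ≤ Literature.Probability.Percolation.bondDomainCrossingProb R δ ∧ Literature.Probability.Percolation.bondDomainCrossingProb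 R δ ≤ gp δ 1 (zp δ) + e δ

/-- item stmt-CriticalPhenomena-11173 · support · rank 4 · open · by planner
why it might fail: The transfer needs measurability and μ-continuity of E_α(z) in the Schramm–Smirnov quad space (GPS-type arm events, arXiv:1008.1378 §2) and control of the nearest-vertex discretisation (`discreteArc`, `nearestSite`) at arcs and corners; a boundary effect could spoil exact relabelling in the limit.
sources: DKKMO2020Rotational, GarbanPeteSchramm2013, SchrammSmirnov2011, Tassion2024
[crux] card K3: DKKMO rotation invariance of the quad-crossing scaling limits (hypothesis = the
statement of item RotationInput, inlined) transfers to separating probabilities at interior points: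
for a 3-marked domain T whose carrier is the open equilateral triangle on its marks and ρ z = m +
l(z − m) the turn permuting the marks cyclically (l(pt i − m) = pt (i+1) − m), every locally uniform
limit G of (H^{u_n}_α)_α satisfies G_{α+1}(ρ z) = G_α(z) on T (exact relabelling H_α(ρT) =
H_{α+1}(T) at every mesh + asymptotic rotation invariance). [difficulty: L] -/
@[route_item "route-CriticalPhenomena-CardyMaterialLaw", crux]
def SeparatingRotationCovariance : Prop :=
  (∀ μ ∈ Literature.Probability.Percolation.QuadCrossing.subseqQuadLimits (Set.univ : Set ℂ), ∀ θ : ℝ, Literature.Probability.Percolation.QuadCrossing.isometryLaw (rotation (Circle.exp θ)).toIsometryEquiv μ = μ) → ∀ (T : Literature.Probability.RandomPlanarGeometry.MarkedDomain 3) (m l : ℂ), T.carrier = Literature.Probability.Percolation.openTriangle (T.pt 0) (T.pt 1) (T.pt 2) → (∀ i : Fin 3, l * (T.pt i - m) = T.pt (i + 1) - m) → ∀ (u : ℕ → ℝ) (G : Fin 3 → ℂ → ℝ), (∀ n, 0 < u n) → Filter.Tendsto u Filter.atTop (nhds 0) → (∀ α : Fin 3, TendstoLocallyUniformlyOn (fun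 (n : ℕ) (z : ℂ) => Literature.Probability.Percolation.bondSeparatingProb T α (u n) z) (G α) Filter.atTop T.carrier) → ∀ α : Fin 3, ∀ z ∈ T.carrier, G (α + 1) (m + l * (z - m)) = G α z

/-- item stmt-CriticalPhenomena-0707 · support · rank 9 · open · by planner
sources: BollobasRiordan2006, Smirnov2001, Beffara2007
X_C2 (informal until defn CardySmirnovScheme lands): for every conformal triangle (Ω; a1,a2,a3) with
a fourth marked boundary point d, bond percolation on δZ^2 at p=1/2 admits a Cardy–Smirnov
observable scheme (H^δ_1,H^δ_2,H^δ_3 : Ω_δ → [0,1]) satisfying (S1) Cardy–Carleson boundary values,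
(S2) uniform Hölder equicontinuity, (S3) vanishing Morera defect of F_δ = Σ τ^{j-1} H^δ_j and of Σ
H^δ_j along every fixed smooth loop, (S4) H^δ_3(d_δ) = bondDomainCrossingProb + o(1). Intended Lean
shape: ∃ (S : CardySmirnovScheme R), True for every R : ConformalRectangle — existence is asserted
HERE, not in the structure. -/
@[route_item "route-CriticalPhenomena-CardyMaterialLaw", crux]
def BondSmirnovFamilies : Prop :=
  ∀ (R : Literature.Probability.RandomPlanarGeometry.ConformalRectangle) (a b c d : ℂ) (ψ : Literature.Probability.RandomPlanarGeometry.ConformalEquiv R.carrier (Literature.Probability.Percolation.openTriangle a b c)), Literature.Probability.Percolation.IsEquilateral a b c → d ∈ openSegment ℝ c a → Literature.Probability.Percolation.IsCarlesonMap R a b c d ψ → ∃ δ₀ > (0 : ℝ), ∃ gm gp : ℝ → Fin 3 → ℂ → ℝ, Literature.Probability.Percolation.IsSmirnovFamily R a b c δ₀ gm ∧ Literature.Probability.Percolation.IsSmirnovFamily R a b c δ₀ gp ∧ ∃ (zm zp : ℝ → ℂ) (e : ℝ → ℝ), (∀ δ ∈ Set.Ioo 0 δ₀, zm δ ∈ R.carrier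 ∧ zp δ ∈ R.carrier) ∧ Filter.Tendsto zm (nhdsWithin 0 (Set.Ioi 0)) (nhds (R.pt 3)) ∧ Filter.Tendsto zp (nhdsWithin 0 (Set.Ioi 0)) (nhds (R.pt 3)) ∧ Filter.Tendsto e (nhdsWithin 0 (Set.Ioi 0)) (nhds 0) ∧ ∀ δ ∈ Set.Ioo 0 δ₀, gm δ 1 (zm δ) - e δ ≤ Literature.Probability.Percolation.bondDomainCrossingProb R δ ∧ Literature.Probability.Percolation.bondDomainCrossingProb R δ ≤ gp δ 1 (zp δ) + e δ

/-- item stmt-CriticalPhenomena-10270 · support · rank 9 · open · by planner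
sources: DKKMO2020Rotational, Tassion2024, SchrammSmirnov2011
[support] DKKMO rotation invariance in ℋ form (arXiv:2012.11672 v1 Thm 1.2 / Cor 1.3 at q = 1;
Tassion2024): every subsequential quad-crossing limit of bond-ℤ² over the whole plane is invariant
under all rotations (isometryLaw (rotation e^{iα}) μ = μ). A published theorem, in tree only per
quad and unproved (`dkkmo_crossing_rotation_invariance`); kept as an explicit item so that the
deciding theorem has no hidden hypothesis and the cone stays clean. [difficulty: L] -/
@[route_item "route-CriticalPhenomena-CardyMaterialLaw", crux]
def RotationInput : Prop :=
  ∀ μ ∈ Literature.Probability.Percolation.QuadCrossing.subseqQuadLimits (Set.univ : Set ℂ), ∀ α : ℝ, Literature.Probability.Percolation.QuadCrossing.isometryLaw (rotation (Circle.exp α)).toIsometryEquiv μ = μ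

/-- item stmt-CriticalPhenomena-11175 · support · rank 9 · open · by planner
sources: BollobasRiordan2006, AstalaIwaniecMartin2008, arXiv:0909.4499
[support] the card's tier (B) as one analytic theorem (ℤ₃-kill + sweep): AutonomousLaw →
LimitRegularity → SeparatingRotationCovariance → RotationInput → Z2SeparatingData →
BondSmirnovFamilies. Proof plan: fix R, Carleson datum of orientation s, a family g of
Z2SeparatingData and a uniform limit G along u (so H(forgetLast R) → G locally uniformly on Ω); for
z ∈ Ω with strain σ(z) ≠ 0 take the equilateral `triangleRectangle` T′ of orientation s whose
Carleson-affine limit has strain σ(z) (Claim 24 `smirnov_claim24_holds` with ψ = refl, after the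
kill: on T′, covariance + chain rule give w(ρz) = s·shift w(z) while the law at z and ρz gives w(ρz)
= w(z), so w_{α+1} = s w_α), pass to a subsequence of u along which T′ converges (equicontinuity
from Z2SeparatingData + Arzelà–Ascoli) and read the law of that subsequence at both domains: w(z) =
L′ s σ(z) ∈ {w_{α+1} = s w_α}; σ(z) = 0 uses L s 0 = 0. Hence G_{i+1} − s G_i is ℂ-differentiable on
Ω, Cauchy–Goursat gives (36) on every solid triangle, and g is an IsSmirnovFamily. [difficulty: M] -/
@[route_item "route-CriticalPhenomena-CardyMaterialLaw", crux]
def MaterialLawKill : Prop :=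
  AutonomousLaw → LimitRegularity → SeparatingRotationCovariance → RotationInput → Z2SeparatingData → BondSmirnovFamilies

/-- item stmt-CriticalPhenomena-11176 · assembly · rank 1 · open · by planner
sources: BollobasRiordan2006, Smirnov2001
[assembly] AutonomousLaw → LimitRegularity → SeparatingRotationCovariance → Z2SeparatingData →
RotationInput → MaterialLawKill → CardyFormulaZ2 (provable now: compose MaterialLawKill with the
argument of `closes`). -/
@[route_item "route-CriticalPhenomena-CardyMaterialLaw", crux]
def Assembly : Prop :=
  AutonomousLaw → LimitRegularity → SeparatingRotationCovariance → Z2SeparatingData → RotationInput → MaterialLawKill → CardyFormulaZ2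

/-! D-0027 §2.1 — DECIDING THEOREM (planner-authored via `route open/edit --closes-file`; by planner-plancard-CriticalPhenomena-CardyFormu-1b5f4ed1-0 2026-08-15T16:53:21Z):
its hypotheses are this route's items and its conclusion the sub-problem Statement (glue_lint), and it elaborates with this file. -/

@[closes "route-CriticalPhenomena-CardyMaterialLaw"] theorem closes : AutonomousLaw → LimitRegularity → SeparatingRotationCovariance → Z2SeparatingData → RotationInput → MaterialLawKill → BondSmirnovFamilies → Assembly → _root_.CardyFormulaZ2 := fun h_AutonomousLaw h_LimitRegularity h_SeparatingRotationCovariance h_Z2SeparatingData h_RotationInput h_MaterialLawKill _h_BondSmirnovFamilies _h_Assembly => by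
  -- the material-law kill supplies Bollobás–Riordan's discrete half (D) for bond percolation on ℤ²
  have hD : BondSmirnovFamilies := h_MaterialLawKill h_AutonomousLaw h_LimitRegularity
    h_SeparatingRotationCovariance h_RotationInput h_Z2SeparatingData
  -- Carleson-form convergence for bond percolation, by the tree's PROVED continuum half
  -- ((M) lattice triangles suffice, (U) Claim 24, Arzelà–Ascoli in `IsSmirnovFamily.tendsto_apply_one`)
  have hA : ∀ (R : Literature.Probability.RandomPlanarGeometry.ConformalRectangle) (a b c d : ℂ)
      (ψ : Literature.Probability.RandomPlanarGeometry.ConformalEquiv R.carrier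
        (Literature.Probability.Percolation.openTriangle a b c)),
      Literature.Probability.Percolation.IsEquilateral a b c → d ∈ openSegment ℝ c a →
        Literature.Probability.Percolation.IsCarlesonMap R a b c d ψ →
          Filter.Tendsto (Literature.Probability.Percolation.bondDomainCrossingProb R)
            (nhdsWithin 0 (Set.Ioi 0)) (nhds (Literature.Probability.Percolation.carlesonRatio a c d)) := by
    intro R a b c d ψ habc hd hψ
    obtain ⟨δ₀, hδ₀, gm, gp, hgm, hgp, zm, zp, e, hzmem, hzm, hzp, he, hsand⟩ :=
      hD R a b c d ψ habc hd hψ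
    have hM := Literature.Probability.Percolation.triangleIntegral_eq_zero_of_forall_lattice_holds
    have hU := Literature.Probability.Percolation.smirnov_claim24_holds
    have h1 := hgm.tendsto_apply_one hM hU hδ₀ habc hd hψ (fun δ hδ => (hzmem δ hδ).1) hzm
    have h2 := hgp.tendsto_apply_one hM hU hδ₀ habc hd hψ (fun δ hδ => (hzmem δ hδ).2) hzp
    have hev : ∀ᶠ δ in nhdsWithin (0 : ℝ) (Set.Ioi 0), δ ∈ Set.Ioo 0 δ₀ := Ioo_mem_nhdsGT hδ₀
    have hlow : Filter.Tendsto (fun δ => gm δ 1 (zm δ) - e δ) (nhdsWithin 0 (Set.Ioi 0))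
        (nhds (Literature.Probability.Percolation.carlesonRatio a c d)) := by
      simpa using h1.sub he
    have hup : Filter.Tendsto (fun δ => gp δ 1 (zp δ) + e δ) (nhdsWithin 0 (Set.Ioi 0))
        (nhds (Literature.Probability.Percolation.carlesonRatio a c d)) := by
      simpa using h2.add he
    exact tendsto_of_tendsto_of_tendsto_of_le_of_le' hlow hup (hev.mono fun δ hδ => (hsand δ hδ).1)
      (hev.mono fun δ hδ => (hsand δ hδ).2)
  -- Cardy's formula from Carleson's form: (B) Carleson maps exist, (C) the Cardy–Carleson identity (both proved)
  intro R φ x hφ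
  obtain ⟨a, b, c, d, ψ, habc, hd, hψ⟩ := Literature.Probability.Percolation.exists_isCarlesonMap_holds R
  rw [Literature.Probability.Percolation.cardyFunction_crossRatio_eq_carlesonRatio_holds R a b c d ψ φ x
    habc hd hψ hφ]
  exact hA R a b c d ψ habc hd hψ

end Summit.CriticalPhenomena.CardyFormulaZ2.Theses.CardyMaterialLaw
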